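import Summits.QuantumFields.YangMills.Theorems.SmallFieldWideningLargeFieldMassRefinementTailStubBoundedHeight
import Summits.QuantumFields.YangMills.Theorems.SmallFieldWideningLargeFieldMassRefinementTailElementaryEnvelopeProfile
import Literature.MathematicalPhysics.QuantumFieldTheory.Balaban1983to89.B10Eq38TorusDomains
import Literature.MathematicalPhysics.QuantumFieldTheory.Balaban1983to89.B10Eq39CollarVolume
import Literature.MathematicalPhysics.QuantumFieldTheory.Balaban1983to89.T3LevelShift

/-!
# Route `SmallFieldWidening`, crux r3 `LargeFieldMassRefinementTail` (stmt-QuantumFields-22884), line `birth` skeleton v8 (lead ym-line-sfw-p2 gen 33) —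
# the registered stub `stub_localNewLevelTail` in its DEF-FREE (finest-lattice ball) form, PROVED; with the neighbourhood-agnostic general form

Lead prover `ym-line-sfw-p2` (gen 33, 2026-08-28).  Rung R3 (`YM3TorusSU2`) is a RECORD rung: no summit and nothing about the Yang–Mills mass gap is
proved here.  This is the TIGHTEN half of the planner's line g6-B «additive unit-stability ladder / local-split» (child crux r4 `PlainStabAdd`,
stmt-QuantumFields-27718) as registered on crux 22884 by skeleton v8 (12:40Z): the same content as the width seat's column form
`PlainStabAdd.stub_localNewLevelTail : LocalNewLevelTail` (`Theorems/SmallFieldWideningPlainStabAddLocalNewLevelTail.lean`, landed for 27718), typed WITHOUT the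
`colUp`/`nearCol` definitions — «near the unit plaquette `q`» is the finest-lattice `ℓ¹` ball of radius `r·L^{k+1}` finest steps (= `r` unit steps) about
`toFine (k+1) (plaqShift _ q).src` — and derived from a GENERAL form valid for ANY family of finest-plaquette sets of unit-volume-bounded cardinality
(`sum_newLevel_largeField_le`), which also serves suppliers of the interface of record `LocalStepFloor` (arbitrary guards `S_K`).  The RG half of the line
(`stub_localSmallStep` / `stub_localStepFloor`) stays OPEN.

WHAT.  For the run `K` of a Bałaban three-torus family `F` at unit coupling `γ` the finest lattice has spacing `L^{-K}`, coupling `g_K² = γL^{-K}` and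
small-field threshold `θ(K) = g_K·p(g_K)` ([Balaban1985UV3] (7) p.257).  The stub asks that the masses of the events «some finest plaquette of run `k+1`
near `q` is `θ(k+1)`-LARGE» be summable over the runs `k+1 ∈ (k₀, K]` with a total `≤ C_τ(r)·γ^{-N_τ}·e^{−c_τ p(√γ)²}`, rate `c_τ` and power `N_τ`
independent of the radius `r`, the constant independent of the family (volume) and of `q, k₀, K`.

HOW (elementary over three tree theorems).
* §1 `newLevel_largeField_le_card_mul` — one run: `{¬ PlaqSmallOn S θ} ⊆ ⋃_{p ∈ T} {θ ≤ |U(∂p)|}` for `S ⊆ T` finite, union bound.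
* §2 `card_plaq_filter_tdist_le` — the plaquettes with source in an `ℓ¹` ball of radius `R` number `≤ (2R+1)^d·d²` (`B10Eq39CollarVolume.card_ball_le` and the
  injection `p ↦ (p.src, p.μ, p.ν)`); `card_plaq_near_le`: radius `r·L^K` in `d = 3` gives `≤ 9(2r+1)³·L^{3K}`.
* §3 `geometric_step` — `V·L^{3j}·C·(γ^{-1}L^{j})^N·e^{−c p(g_j)²} ≤ (V·C·e^{B}·γ^{-N}·e^{−(c/2)p(√γ)²})·2^{-j}` for `0 < γ ≤ 1` (split
  `e^{−c p_j²} = e^{−(c/2)p_j²}·e^{−(c/2)p_j²}`, `p_j ≥ p_0` by `…ElementaryEnvelope.pFun_coupling_mono`, and the line's own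
  `LargeFieldMassRefinementTail.term_le_geometric` at `m = 0`, rate `c/2`, whose largeness condition is void for `γ ≤ 1`).
* §4 ★ `sum_newLevel_largeField_le` — THE GENERAL FORM: for ANY plaquette-set family `S K ⊆ T K` with `|T K| ≤ V·L^{3K}` the sum over the runs `k+1`,
  `k ∈ [k₀, K)`, of the masses of `{¬ PlaqSmallOn (S (k+1)) θ(k+1)}` is `≤ 2·V·C·e^{B}·γ^{-N}·e^{−(c/2) p(√γ)²}`, by the volume-uniform finest-level
  per-plaquette tail `FirstExitDeepBoundedHeight.perPlaquette_boundedHeight_uniform 0` and `Σ 2^{-j} ≤ 2`.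
* §5 ★★ `stub_localNewLevelTail` — the registered stub of skeleton v8 of crux stmt-QuantumFields-22884, verbatim.

References: T. Bałaban, Commun. Math. Phys. **102** (1985) 255–275 [Balaban1985UV3] ((7) p.257, Lemma 3 p.269, (71) p.273, p.258);
Commun. Math. Phys. **109** (1987) 249–301 [Balaban1987RG1] ((0.1) p.251).
-/

set_option autoImplicit false

noncomputable section

open MeasureTheory
open scoped BigOperators

namespace Summit.QuantumFields.YangMills.Theorems.LargeFieldMassRefinementTailLocalNewLevelTailBall

open Literature.MathematicalPhysics.QuantumFieldTheory.Balaban1983to89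
open Literature.MathematicalPhysics.QuantumFieldTheory.Balaban1983to89.T3ContinuumYM3Torus
open Literature.MathematicalPhysics.QuantumFieldTheory.Balaban1983to89.T3UnitScaleTilt
open Literature.MathematicalPhysics.QuantumFieldTheory.Balaban1983to89.T3UnitLawDensityEML (ℰp)
open Literature.MathematicalPhysics.QuantumFieldTheory.Balaban1983to89.T3LevelShift
open Literature.MathematicalPhysics.QuantumFieldTheory.Balaban1983to89.B10Eq38TorusDomains (toFine)
open Literature.MathematicalPhysics.QuantumFieldTheory.Balaban1983to89.B10Eq39CollarVolume (ball mem_ball card_ball_le)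
open Summit.QuantumFields.YangMills.Theorems.FirstExitDeepBoundedHeight (perPlaquette_boundedHeight_uniform)
open Summit.QuantumFields.YangMills.Theorems.LargeFieldMassRefinementTail (term_le_geometric)
open Summit.QuantumFields.YangMills.Theorems.LargeFieldMassRefinementTailElementaryEnvelope (pFun_coupling_mono)

/-! ## §1 One run: the union bound over a finite plaquette set -/

/-- **One run, union bound**: if `S ⊆ T` (`T` finite) and every plaquette `p ∈ T` has `Gibbs_K{θ ≤ |U(∂p) − 1|} ≤ B`, then
`Gibbs_K{¬ (all p ∈ S are θ-small)} ≤ |T|·B`. [cite: Balaban1985UV3, Lemma 3 p.269] -/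
theorem newLevel_largeField_le_card_mul (F : T3Family) {γ : ℝ} (hγ : 0 ≤ γ) (K : ℕ) (S : Set (Plaq (F.P K) 0))
    (T : Finset (Plaq (F.P K) 0)) (hST : ∀ p ∈ S, p ∈ T) (θ B : ℝ)
    (hB : ∀ p ∈ T, (gibbsK F ℰp γ K).real {U | θ ≤ GaugeGroup.dist1 (GaugeField.plaqHol U p)} ≤ B) :
    (gibbsK F ℰp γ K).real {U | ¬ PlaqSmallOn S θ U} ≤ T.card * B := by
  haveI := isProbabilityMeasure_gibbsK F ℰp hγ K
  have hsub : {U : GaugeField (F.P K) 0 (Matrix.specialUnitaryGroup (Fin 2) ℂ) | ¬ PlaqSmallOn S θ U} ⊆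
      ⋃ p ∈ T, {U | θ ≤ GaugeGroup.dist1 (GaugeField.plaqHol U p)} := by
    intro U hU
    simp only [Set.mem_setOf_eq, PlaqSmallOn, not_forall, not_lt] at hU
    obtain ⟨p, hp, hle⟩ := hU
    simp only [Set.mem_iUnion, Set.mem_setOf_eq]
    exact ⟨p, hST p hp, hle⟩
  calc (gibbsK F ℰp γ K).real {U | ¬ PlaqSmallOn S θ U}
      ≤ (gibbsK F ℰp γ K).real (⋃ p ∈ T, {U | θ ≤ GaugeGroup.dist1 (GaugeField.plaqHol U p)}) :=
        measureReal_mono hsub (measure_ne_top _ _)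
    _ ≤ ∑ p ∈ T, (gibbsK F ℰp γ K).real {U | θ ≤ GaugeGroup.dist1 (GaugeField.plaqHol U p)} :=
        measureReal_biUnion_finset_le T _
    _ ≤ ∑ _p ∈ T, B := Finset.sum_le_sum hB
    _ = T.card * B := by rw [Finset.sum_const, nsmul_eq_mul]

/-! ## §2 Counting the finest plaquettes near a site -/

/-- **Plaquettes with source in an `ℓ¹` ball**: at most `(2R+1)^d·d²` plaquettes of a torus `Site P j` have their source within
torus distance `R` of a given site (`card_ball_le` and the injection `p ↦ (p.src, p.μ, p.ν)`). [cite: Balaban1985UV3, p.258] -/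
theorem card_plaq_filter_tdist_le {P : Params} {j : ℕ} (c : Site P j) (R : ℕ) :
    (Finset.univ.filter fun p : Plaq P j => Site.tdist c p.src ≤ R).card ≤ (2 * R + 1) ^ P.d * P.d ^ 2 := by
  classical
  let f : Plaq P j → Site P j × (Fin P.d × Fin P.d) := fun p => (p.src, (p.μ, p.ν))
  have hmaps : ∀ p ∈ (Finset.univ.filter fun p : Plaq P j => Site.tdist c p.src ≤ R),
      f p ∈ ball c R ×ˢ (Finset.univ : Finset (Fin P.d × Fin P.d)) := by
    intro p hp
    simp only [Finset.mem_filter, Finset.mem_univ, true_and] at hp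
    exact Finset.mem_product.mpr ⟨mem_ball.mpr hp, Finset.mem_univ _⟩
  have hinj : Set.InjOn f ↑(Finset.univ.filter fun p : Plaq P j => Site.tdist c p.src ≤ R) := by
    intro p _ p' _ h
    obtain ⟨s, μ, ν, hμν⟩ := p
    obtain ⟨s', μ', ν', hμν'⟩ := p'
    simp only [f, Prod.mk.injEq] at h
    obtain ⟨rfl, rfl, rfl⟩ := h
    rfl
  calc (Finset.univ.filter fun p : Plaq P j => Site.tdist c p.src ≤ R).card
      ≤ (ball c R ×ˢ (Finset.univ : Finset (Fin P.d × Fin P.d))).card := Finset.card_le_card_of_injOn f hmaps hinj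
    _ = (ball c R).card * (P.d * P.d) := by
        rw [Finset.card_product, Finset.card_univ, Fintype.card_prod, Fintype.card_fin]
    _ ≤ (2 * R + 1) ^ P.d * P.d ^ 2 := by
        rw [sq]
        exact Nat.mul_le_mul_right _ (card_ball_le c R)

/-- **The local count in `d = 3`**: the finest plaquettes of run `K` with source within `r·L^K` finest steps of a site number
`≤ 9·(2r+1)³·L^{3K}` (real form). [cite: Balaban1985UV3, p.258] -/
theorem card_plaq_near_le (F : T3Family) (K : ℕ) (c : Site (F.P K) 0) (r : ℕ) :
    ((Finset.univ.filter fun p : Plaq (F.P K) 0 => Site.tdist c p.src ≤ r * F.L ^ K).card : ℝ) ≤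
      9 * (2 * (r : ℝ) + 1) ^ 3 * (F.L : ℝ) ^ (3 * K) := by
  have h := card_plaq_filter_tdist_le c (r * F.L ^ K)
  rw [T3Family.P_d] at h
  have hL1 : (1 : ℝ) ≤ (F.L : ℝ) ^ K := one_le_pow₀ (by exact_mod_cast le_of_lt F.hL.2)
  have hcast : ((Finset.univ.filter fun p : Plaq (F.P K) 0 => Site.tdist c p.src ≤ r * F.L ^ K).card : ℝ) ≤
      (2 * ((r : ℝ) * (F.L : ℝ) ^ K) + 1) ^ 3 * 9 := by
    exact_mod_cast h
  refine hcast.trans ?_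
  have hrad : 2 * ((r : ℝ) * (F.L : ℝ) ^ K) + 1 ≤ (2 * (r : ℝ) + 1) * (F.L : ℝ) ^ K := by
    nlinarith [hL1, (Nat.cast_nonneg r : (0 : ℝ) ≤ r)]
  have h0 : 0 ≤ 2 * ((r : ℝ) * (F.L : ℝ) ^ K) + 1 := by positivity
  calc (2 * ((r : ℝ) * (F.L : ℝ) ^ K) + 1) ^ 3 * 9 ≤ ((2 * (r : ℝ) + 1) * (F.L : ℝ) ^ K) ^ 3 * 9 := by gcongr
    _ = 9 * (2 * (r : ℝ) + 1) ^ 3 * (F.L : ℝ) ^ (3 * K) := by rw [mul_pow, ← pow_mul, mul_comm K 3]; ring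

/-! ## §3 The scalar estimate: one run's bound is geometric with the unit-scale Gaussian factor in front -/

/-- **The scalar step**: for `L > 1`, `0 < γ ≤ 1`, `b₀ > 0`, `p₀ ≥ 1`, `c > 0`, `C, V ≥ 0` and every `j`,
`V·L^{3j}·(C·(γL^{-j})^{-N}·e^{−c·p(g_j)²}) ≤ (V·(C·e^{B})·γ^{-N}·e^{−(c/2)·p(√γ)²})·(1/2)^j`, `B` the constant of `term_le_geometric` at
rate `c/2`: half of the Gaussian factor is kept at the unit scale (`p(g_j) ≥ p(g_0)`), the other half beats `L^{(3+N)j}`. [folklore] -/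
theorem geometric_step (F : T3Family) {γ b₀ p₀ c C V : ℝ} (hγ : 0 < γ) (hγ1 : γ ≤ 1) (hb₀ : 0 < b₀) (hp₀ : 1 ≤ p₀)
    (hc : 0 < c) (hC : 0 ≤ C) (hV : 0 ≤ V) (N j : ℕ) :
    V * (F.L : ℝ) ^ (3 * j) * (C * ((γ * ((F.L : ℝ)⁻¹) ^ j)⁻¹) ^ N *
        Real.exp (-(c * B10.pFun b₀ p₀ (Real.sqrt (γ * ((F.L : ℝ)⁻¹) ^ j)) ^ 2))) ≤
      (V * (C * Real.exp ((((3 : ℝ) + N) * Real.log F.L + Real.log 2) ^ 2 / (4 * (c / 2 * b₀ ^ 2 * Real.log F.L ^ 2 / 16)))) *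
          γ⁻¹ ^ N * Real.exp (-(c / 2 * B10.pFun b₀ p₀ (Real.sqrt γ) ^ 2))) * ((1 : ℝ) / 2) ^ j := by
  have hL : 1 < F.L := F.hL.2
  have hL1 : (1 : ℝ) < F.L := by exact_mod_cast hL
  set pj : ℝ := B10.pFun b₀ p₀ (Real.sqrt (γ * ((F.L : ℝ)⁻¹) ^ j)) with hpj
  set p0 : ℝ := B10.pFun b₀ p₀ (Real.sqrt γ) with hp0
  -- `0 ≤ p(√γ) ≤ p(g_j)`
  have hsqrt1 : Real.sqrt γ ≤ 1 := (Real.sqrt_le_sqrt hγ1).trans (le_of_eq Real.sqrt_one)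
  have hp0nn : 0 ≤ p0 := B10.pFun_nonneg b₀ p₀ (Real.sqrt γ) hb₀.le (Real.sqrt_pos.mpr hγ) hsqrt1
  have hp0le : p0 ≤ pj := by
    have h := pFun_coupling_mono F hγ hγ1 hb₀.le (zero_le_one.trans hp₀) (Nat.zero_le j)
    simpa only [pow_zero, mul_one] using h
  -- split the Gaussian factor
  have hsplit : Real.exp (-(c * pj ^ 2)) = Real.exp (-(c / 2 * pj ^ 2)) * Real.exp (-(c / 2 * pj ^ 2)) := by
    rw [← Real.exp_add]; ring_nf
  have hmono : Real.exp (-(c / 2 * pj ^ 2)) ≤ Real.exp (-(c / 2 * p0 ^ 2)) := by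
    refine Real.exp_le_exp.mpr (neg_le_neg (mul_le_mul_of_nonneg_left ?_ (half_pos hc).le))
    exact pow_le_pow_left₀ hp0nn hp0le 2
  -- the line's geometric domination at `m = 0`, rate `c/2` (its largeness condition is void for `γ ≤ 1`)
  have hk : 2 * max (Real.log γ) 0 ≤ (j : ℝ) * Real.log F.L := by
    rw [max_eq_right (Real.log_nonpos hγ.le hγ1), mul_zero]
    exact mul_nonneg (Nat.cast_nonneg j) (Real.log_pos hL1).le
  have hgeo := term_le_geometric hL 0 N hb₀ hp₀ (half_pos hc) hC hγ (k := j) hk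
  simp only [Nat.zero_add, mul_zero, pow_zero, mul_one] at hgeo
  calc V * (F.L : ℝ) ^ (3 * j) * (C * ((γ * ((F.L : ℝ)⁻¹) ^ j)⁻¹) ^ N * Real.exp (-(c * pj ^ 2)))
      = V * Real.exp (-(c / 2 * pj ^ 2)) *
          (C * (F.L : ℝ) ^ (3 * j) * ((γ * ((F.L : ℝ)⁻¹) ^ j)⁻¹) ^ N * Real.exp (-(c / 2 * pj ^ 2))) := by
        rw [hsplit]; ring
    _ ≤ V * Real.exp (-(c / 2 * p0 ^ 2)) *
          ((C * γ⁻¹ ^ N * Real.exp ((((3 : ℝ) + N) * Real.log F.L + Real.log 2) ^ 2 /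
              (4 * (c / 2 * b₀ ^ 2 * Real.log F.L ^ 2 / 16)))) * ((1 : ℝ) / 2) ^ j) := by
        gcongr
    _ = _ := by ring

/-! ## §4 The general form: any plaquette-set family of unit-volume-bounded cardinality -/

/-- ★ **THE SUMMABLE NEW-LEVEL LARGE-FIELD TAIL, GENERAL FORM.**  For every block size `L` and profile `0 < b₀`, `1 ≤ p₀` there are
`γ₁ ∈ (0,1]`, a rate `c > 0` and a power `N` (those of the volume-uniform finest-level per-plaquette tail, the rate halved) such that for
every cardinality budget `V ≥ 0` there is `C ≥ 0` with: for every family `F` (`F.L = L`), every `0 < γ ≤ γ₁`, every family of finest-level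
plaquette sets `S K ⊆ T K` with `|T K| ≤ V·L^{3K}`, and all `k₀, K`,
`Σ_{k ∈ [k₀,K)} Gibbs_{k+1}{¬ (S (k+1) is θ(k+1)-small)} ≤ C·γ^{-N}·e^{−c·p(√γ)²}`. [cite: Balaban1985UV3, (7) p.257, Lemma 3 p.269 and (71) p.273] -/
theorem sum_newLevel_largeField_le :
    ∀ (L : ℕ) (b₀ p₀ : ℝ), 0 < b₀ → 1 ≤ p₀ → ∃ (γ₁ c : ℝ) (N : ℕ), 0 < γ₁ ∧ γ₁ ≤ 1 ∧ 0 < c ∧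
      ∀ V : ℝ, 0 ≤ V → ∃ C : ℝ, 0 ≤ C ∧
        ∀ (F : T3Family) (γ : ℝ), F.L = L → 0 < γ → γ ≤ γ₁ →
          ∀ (S : (K : ℕ) → Set (Plaq (F.P K) 0)) (T : (K : ℕ) → Finset (Plaq (F.P K) 0)),
            (∀ K, ∀ p ∈ S K, p ∈ T K) → (∀ K, ((T K).card : ℝ) ≤ V * (L : ℝ) ^ (3 * K)) →
            ∀ k₀ K : ℕ, ∑ k ∈ Finset.Ico k₀ K,
                (gibbsK F ℰp γ (k + 1)).real {U | ¬ PlaqSmallOn (S (k + 1)) (θBal F.L γ b₀ p₀ (k + 1)) U} ≤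
              C * (γ⁻¹) ^ N * Real.exp (-(c * B10.pFun b₀ p₀ (Real.sqrt γ) ^ 2)) := by
  intro L b₀ p₀ hb₀ hp₀
  obtain ⟨γ₁, C₀, c, N, hγ₁, hγ₁1, hc, hC₀, htail⟩ := perPlaquette_boundedHeight_uniform 0 L b₀ p₀ hb₀ (by linarith)
  by_cases hL : 1 < L
  swap
  · refine ⟨γ₁, c, N, hγ₁, hγ₁1, hc, fun V _ => ⟨0, le_rfl, ?_⟩⟩
    intro F γ hFL
    exact absurd (hFL ▸ F.hL.2) hL
  have hL1 : (1 : ℝ) < L := by exact_mod_cast hL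
  -- the constant of the geometric domination at rate `c/2`
  set B : ℝ := (((3 : ℝ) + N) * Real.log L + Real.log 2) ^ 2 / (4 * (c / 2 * b₀ ^ 2 * Real.log L ^ 2 / 16)) with hB
  refine ⟨γ₁, c / 2, N, hγ₁, hγ₁1, half_pos hc, fun V hV => ⟨2 * (V * (C₀ * Real.exp B)), by positivity, ?_⟩⟩
  intro F γ hFL hγ hle S T hST hT k₀ K
  subst hFL
  have hγ1 : γ ≤ 1 := hle.trans hγ₁1
  set M : ℝ := V * (C₀ * Real.exp B) * γ⁻¹ ^ N * Real.exp (-(c / 2 * B10.pFun b₀ p₀ (Real.sqrt γ) ^ 2)) with hM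
  have hM0 : 0 ≤ M := by positivity
  -- one run `j = k + 1`: union bound × per-plaquette tail × count, then the scalar step
  have hrun : ∀ j : ℕ, (gibbsK F ℰp γ j).real {U | ¬ PlaqSmallOn (S j) (θBal F.L γ b₀ p₀ j) U} ≤ M * ((1 : ℝ) / 2) ^ j := by
    intro j
    have hper : ∀ p ∈ T j, (gibbsK F ℰp γ j).real {U | θBal F.L γ b₀ p₀ j ≤ GaugeGroup.dist1 (GaugeField.plaqHol U p)} ≤
        C₀ * ((γ * ((F.L : ℝ)⁻¹) ^ j)⁻¹) ^ N * Real.exp (-(c * B10.pFun b₀ p₀ (Real.sqrt (γ * ((F.L : ℝ)⁻¹) ^ j)) ^ 2)) := by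
      intro p _
      have h := htail F γ rfl hγ hle j 0 (Nat.zero_le j) le_rfl p
      simpa only [Nat.sub_zero, Averaging.iter, id_eq] using h
    have h1 := newLevel_largeField_le_card_mul F hγ.le j (S j) (T j) (hST j) _ _ hper
    have h2 : ((T j).card : ℝ) * (C₀ * ((γ * ((F.L : ℝ)⁻¹) ^ j)⁻¹) ^ N *
          Real.exp (-(c * B10.pFun b₀ p₀ (Real.sqrt (γ * ((F.L : ℝ)⁻¹) ^ j)) ^ 2))) ≤
        V * (F.L : ℝ) ^ (3 * j) * (C₀ * ((γ * ((F.L : ℝ)⁻¹) ^ j)⁻¹) ^ N *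
          Real.exp (-(c * B10.pFun b₀ p₀ (Real.sqrt (γ * ((F.L : ℝ)⁻¹) ^ j)) ^ 2))) :=
      mul_le_mul_of_nonneg_right (hT j) (by positivity)
    exact h1.trans (h2.trans (geometric_step F hγ hγ1 hb₀ hp₀ hc hC₀ hV N j))
  -- sum of the geometric majorants: `Σ_{k ∈ [k₀,K)} (1/2)^{k+1} ≤ Σ (1/2)^k ≤ 2`
  have hgeom : ∑ k ∈ Finset.Ico k₀ K, ((1 : ℝ) / 2) ^ (k + 1) ≤ 2 := by
    have hle1 : ∑ k ∈ Finset.Ico k₀ K, ((1 : ℝ) / 2) ^ (k + 1) ≤ ∑ k ∈ Finset.Ico k₀ K, ((1 : ℝ) / 2) ^ k :=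
      Finset.sum_le_sum fun k _ => pow_le_pow_of_le_one (by norm_num) (by norm_num) (Nat.le_succ k)
    have hle2 := geom_sum_Ico_le_of_lt_one (x := (1 : ℝ) / 2) (m := k₀) (n := K) (by norm_num) (by norm_num)
    have hle3 : ((1 : ℝ) / 2) ^ k₀ / (1 - 1 / 2) ≤ 2 := by
      have : ((1 : ℝ) / 2) ^ k₀ ≤ 1 := pow_le_one₀ (by norm_num) (by norm_num)
      rw [div_le_iff₀ (by norm_num)]
      linarith
    exact hle1.trans (hle2.trans hle3)
  calc ∑ k ∈ Finset.Ico k₀ K, (gibbsK F ℰp γ (k + 1)).real {U | ¬ PlaqSmallOn (S (k + 1)) (θBal F.L γ b₀ p₀ (k + 1)) U}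
      ≤ ∑ k ∈ Finset.Ico k₀ K, M * ((1 : ℝ) / 2) ^ (k + 1) := Finset.sum_le_sum fun k _ => hrun (k + 1)
    _ = M * ∑ k ∈ Finset.Ico k₀ K, ((1 : ℝ) / 2) ^ (k + 1) := by rw [Finset.mul_sum]
    _ ≤ M * 2 := mul_le_mul_of_nonneg_left hgeom hM0
    _ = 2 * (V * (C₀ * Real.exp B)) * γ⁻¹ ^ N * Real.exp (-(c / 2 * B10.pFun b₀ p₀ (Real.sqrt γ) ^ 2)) := by
        rw [hM]; ring

/-! ## §5 The registered stub of skeleton v8 of crux stmt-QuantumFields-22884 (def-free twin of `PlainStabAdd.stub_localNewLevelTail`) -/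

/-- ★★ **`stub_localNewLevelTail` — THE TIGHTEN HALF OF LINE «local-split», PROVED.**  For every block size `L` and Bałaban profile
`0 < b₀`, `2 < p₀` there are `γ₁ ∈ (0,1]`, a rate `c_τ > 0` and a power `N_τ` such that for every radius `r` there is `C_τ ≥ 0` with: for
every three-torus family `F` (`F.L = L`), every `0 < γ ≤ γ₁`, every unit plaquette `q` and all `k₀, K`, the sum over the runs `k+1`,
`k ∈ [k₀, K)`, of the Gibbs masses of «some finest plaquette of run `k+1` with source within `r·L^{k+1}` finest steps of the finest image of
the unit site under `q` is `θ(k+1)`-large» is `≤ C_τ·γ^{-N_τ}·e^{−c_τ·p(√γ)²}` — uniformly in the volume, `q`, `k₀` and `K`.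
[cite: Balaban1985UV3, (7) p.257, Lemma 3 p.269 and (71) p.273] -/
theorem stub_localNewLevelTail :
    ∀ (L : ℕ) (b₀ p₀ : ℝ), 0 < b₀ → 2 < p₀ → ∃ (γ₁ cτ : ℝ) (Nτ : ℕ), 0 < γ₁ ∧ γ₁ ≤ 1 ∧ 0 < cτ ∧
      ∀ r : ℕ, ∃ Cτ : ℝ, 0 ≤ Cτ ∧
        ∀ (F : T3Family) (γ : ℝ), F.L = L → 0 < γ → γ ≤ γ₁ → ∀ (q : Plaq (F.P 0) 0) (k₀ K : ℕ),
          ∑ k ∈ Finset.Ico k₀ K, (gibbsK F ℰp γ (k + 1)).real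
              {U | ¬ PlaqSmallOn {p' : Plaq (F.P (k + 1)) 0 |
                  Site.tdist (toFine (k + 1) (plaqShift (F.sitesPerDir_unit (k + 1)) q).src) p'.src ≤ r * F.L ^ (k + 1)}
                (θBal F.L γ b₀ p₀ (k + 1)) U} ≤
            Cτ * (γ⁻¹) ^ Nτ * Real.exp (-(cτ * B10.pFun b₀ p₀ (Real.sqrt γ) ^ 2)) := by
  intro L b₀ p₀ hb₀ hp₀
  obtain ⟨γ₁, c, N, hγ₁, hγ₁1, hc, hV⟩ := sum_newLevel_largeField_le L b₀ p₀ hb₀ (by linarith)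
  refine ⟨γ₁, c, N, hγ₁, hγ₁1, hc, fun r => ?_⟩
  obtain ⟨C, hC, h⟩ := hV (9 * (2 * (r : ℝ) + 1) ^ 3) (by positivity)
  refine ⟨C, hC, fun F γ hFL hγ hle q k₀ K => ?_⟩
  subst hFL
  exact h F γ rfl hγ hle
    (fun K => {p' : Plaq (F.P K) 0 |
      Site.tdist (toFine K (plaqShift (F.sitesPerDir_unit K) q).src) p'.src ≤ r * F.L ^ K})
    (fun K => Finset.univ.filter fun p' : Plaq (F.P K) 0 =>
      Site.tdist (toFine K (plaqShift (F.sitesPerDir_unit K) q).src) p'.src ≤ r * F.L ^ K)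
    (fun K p hp => Finset.mem_filter.mpr ⟨Finset.mem_univ _, hp⟩)
    (fun K => card_plaq_near_le F K _ r) k₀ K

end Summit.QuantumFields.YangMills.Theorems.LargeFieldMassRefinementTailLocalNewLevelTailBall

end
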